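import Literature.NumberTheory.Weil1964.LocalLerayCocycle
import HarnessLib

/-!
# Three lines: `μ_ψ(Fu, Fv, Fw) = γ_ψ(-B(u,v) B(v,w) B(w,u))` and the rank-one Leray cocycle
# `c(g₁, g₂) = γ_ψ(c₁ c₂ c₁₂)` ([Rangarao1993] Cor. 4.3)

Topic `NumberTheory/Weil1964`; namespace `Literature.NumberTheory.Weil1964`. KERNEL mathematics only (theorems and
private plumbing; no named fact, no `axiom`, no `sorry`). Sequel of `LocalLerayCocycle.lean`.

For three LINES `ℓ₁ = Fu`, `ℓ₂ = Fv`, `ℓ₃ = Fw` in `(V, B)` the Kashiwara form on `ℓ₁ ⊕ ℓ₂ ⊕ ℓ₃ ≅ F³` is the ternary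
form `T(x, y, z) = a xy + b yz + c zx`, `a = B(u,v)`, `b = B(v,w)`, `c = B(w,u)`. If `abc = 0` it is split (a
product of two linear forms), so `γ(T) = 1`; if `abc ≠ 0` the substitution `s = ay + cz`, `t = x + (b/a) z` gives
`T = st - (bc/a) z²`, a hyperbolic plane plus the line `⟨-bc/a⟩ ≃ ⟨-abc⟩`, so **`γ(T) = γ_ψ(-abc)`**
(`lerayWeilIndex_span_singleton`). For the Leray cocycle of the Lagrangian LINE `ℓ = Fu` of a symplectic plane
this is [Rangarao1993, Cor. 4.3] ("Suppose `dim X = 2` and `σⱼ = (aⱼ bⱼ; cⱼ dⱼ)`. Then `c(σ₁, σ₂) = 1` if … , and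
`γ_F(½ c₁c₂(c₁a₂ + d₁c₂) x²)` otherwise"): with `x(g) = B(u, gu)` (the entry `c` of `g` in a symplectic basis
`(u, u*)`), **`c_ℓ(g₁, g₂) = γ_ψ(x(g₁) x(g₂) x(g₁g₂))`** when the product is non-zero and `1` otherwise
(`lerayCocycle_span_singleton`; `x(g₁g₂) = c₁a₂ + d₁c₂`). Conventions: `γ_ψ(a) = weilIndex ψ μ a` is the tree's
Weil index of `x ↦ ψ(a x²)` (Rao writes forms as `½ q`).

## References

* [Rangarao1993] R. Ranga Rao, *On some explicit formulas in the theory of Weil representation*, Pacific J. Math.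
  157 (1993), Cor. 4.3, p. 359; Appendix Thm A.2.
* [LionVergne1980] G. Lion, M. Vergne, *The Weil representation, Maslov index and Theta series*, PM 6 (1980),
  §1.5.1, §1.5.4.
-/

set_option autoImplicit false

noncomputable section

open MeasureTheory QuadraticMap
open Literature.LinearAlgebra.QuadraticForm
open scoped Classical

namespace Literature.NumberTheory.Weil1964

/-! ## §0 Coordinates (plumbing) -/

section Coordinates

variable {F : Type*} [Field F] {V : Type*} [AddCommGroup V] [Module F V]

/-- coordinates `F³ ≃ Fu ⊕ Fv ⊕ Fw`, `(x, y, z) ↦ (xu, yv, zw)`. [folklore] -/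
private def lineCoords (u v w : V) (hu : u ≠ 0) (hv : v ≠ 0) (hw : w ≠ 0) :
    (F × (F × F)) ≃ₗ[F] (↥(F ∙ u) × (↥(F ∙ v) × ↥(F ∙ w))) :=
  (LinearEquiv.toSpanNonzeroSingleton F V u hu).prodCongr
    ((LinearEquiv.toSpanNonzeroSingleton F V v hv).prodCongr (LinearEquiv.toSpanNonzeroSingleton F V w hw))

/-- **the Kashiwara form of three lines in coordinates**: `T(x, y, z) = B(u,v) xy + B(v,w) yz + B(w,u) zx`.
[cite: LionVergne1980, §1.5.1] -/
theorem kashiwaraForm_span_singleton_apply (B : LinearMap.BilinForm F V) {u v w : V} (hu : u ≠ 0) (hv : v ≠ 0)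
    (hw : w ≠ 0) (p : F × (F × F)) :
    (kashiwaraForm B (F ∙ u) (F ∙ v) (F ∙ w)).comp
        ((lineCoords u v w hu hv hw : (F × (F × F)) ≃ₗ[F] _) : (F × (F × F)) →ₗ[F] _) p =
      B u v * (p.1 * p.2.1) + B v w * (p.2.1 * p.2.2) + B w u * (p.2.2 * p.1) := by
  simp only [QuadraticMap.comp_apply, LinearEquiv.coe_coe, lineCoords, LinearEquiv.prodCongr_apply,
    kashiwaraForm_apply, LinearEquiv.toSpanNonzeroSingleton_apply, map_smul, LinearMap.smul_apply, smul_eq_mul]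
  ring

/-- the substitution `(x, y, z) ↦ ((ay + cz, x + (b/a) z), z)` (`a ≠ 0`). [folklore] -/
private def splitCoords (a b c : F) (ha : a ≠ 0) : (F × (F × F)) ≃ₗ[F] ((F × F) × (Fin 1 → F)) where
  toFun p := ((a * p.2.1 + c * p.2.2, p.1 + b / a * p.2.2), fun _ => p.2.2)
  invFun q := (q.1.2 - b / a * q.2 0, ((q.1.1 - c * q.2 0) / a, q.2 0))
  map_add' p p' := by
    refine Prod.ext (Prod.ext ?_ ?_) (funext fun _ => ?_)
    · simp only [Prod.snd_add, Prod.fst_add]; ring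
    · simp only [Prod.snd_add, Prod.fst_add]; ring
    · simp only [Prod.snd_add, Pi.add_apply]
  map_smul' r p := by
    refine Prod.ext (Prod.ext ?_ ?_) (funext fun _ => ?_)
    · simp only [Prod.smul_snd, Prod.smul_fst, smul_eq_mul, RingHom.id_apply]; ring
    · simp only [Prod.smul_snd, Prod.smul_fst, smul_eq_mul, RingHom.id_apply]; ring
    · simp only [Prod.smul_snd, Pi.smul_apply, smul_eq_mul, RingHom.id_apply]
  left_inv p := by
    refine Prod.ext ?_ (Prod.ext ?_ rfl)
    · change p.1 + b / a * p.2.2 - b / a * p.2.2 = p.1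
      ring
    · change (a * p.2.1 + c * p.2.2 - c * p.2.2) / a = p.2.1
      field_simp
      ring
  right_inv q := by
    refine Prod.ext (Prod.ext ?_ ?_) (funext fun i => ?_)
    · change a * ((q.1.1 - c * q.2 0) / a) + c * q.2 0 = q.1.1
      field_simp
      ring
    · change q.1.2 - b / a * q.2 0 + b / a * q.2 0 = q.1.2
      ring
    · change q.2 0 = q.2 i
      rw [Subsingleton.elim i 0]

/-- formula. [folklore] -/
private theorem splitCoords_apply (a b c : F) (ha : a ≠ 0) (p : F × (F × F)) :
    splitCoords a b c ha p = ((a * p.2.1 + c * p.2.2, p.1 + b / a * p.2.2), fun _ => p.2.2) := rfl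

/-- the swap `(x, y, z) ↦ (y, x, z)`. [folklore] -/
private def swap₁₂ : (F × (F × F)) ≃ₗ[F] (F × (F × F)) where
  toFun p := (p.2.1, (p.1, p.2.2))
  invFun p := (p.2.1, (p.1, p.2.2))
  map_add' _ _ := rfl
  map_smul' _ _ := rfl
  left_inv _ := rfl
  right_inv _ := rfl

end Coordinates

section Lines

variable {F : Type*} [Field F] [ValuativeRel F] [TopologicalSpace F] [IsNonarchimedeanLocalField F]
variable [MeasurableSpace F] [BorelSpace F] (μ : Measure F) [μ.IsAddHaarMeasure] {ψ : AddChar F Circle}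
  [Invertible (2 : F)]
variable {V : Type*} [AddCommGroup V] [Module F V] [FiniteDimensional F V]

/-! ## §1 The line `⟨r⟩` -/

/-- **`γ` of the one-dimensional form `r x²` is `γ_ψ(r)`** (`r ≠ 0`). [cite: Rangarao1993, Appendix Thm A.2, p. 366] -/
theorem weilIndexSpace_weightedSumSquares_one (hψ : ψ.IsContinuousNontrivial) {r : F} (hr : r ≠ 0) :
    weilIndexSpace ψ μ (weightedSumSquares F (fun _ : Fin 1 => r)) = weilIndex ψ μ r := by
  rw [weilIndexSpace_eq_weilIndexQF' μ hψ,
    weilIndexQF'_eq_weilIndexDiag μ hψ (c := fun _ : Fin 1 => r) (A := LinearEquiv.refl F (Fin 1 → F))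
      (fun x => rfl),
    weilIndexDiag_of_ne_zero (hc := fun (_ : Fin 1) => hr), Fin.prod_univ_one]

/-! ## §2 Three lines -/

/-- **`μ_ψ(Fu, Fv, Fw) = γ_ψ(-B(u,v) B(v,w) B(w,u))`** for three lines spanned by non-zero vectors with
`B(u,v) B(v,w) B(w,u) ≠ 0`, and `= 1` otherwise: the Kashiwara form `a xy + b yz + c zx` is a hyperbolic plane
plus `⟨-abc⟩` (resp. split). [cite: Rangarao1993, Cor. 4.3, p. 359] -/
theorem lerayWeilIndex_span_singleton (hψ : ψ.IsContinuousNontrivial) (B : LinearMap.BilinForm F V) {u v w : V}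
    (hu : u ≠ 0) (hv : v ≠ 0) (hw : w ≠ 0) :
    lerayWeilIndex ψ μ B (F ∙ u) (F ∙ v) (F ∙ w) =
      if B u v * B v w * B w u = 0 then 1 else weilIndex ψ μ (-(B u v * B v w * B w u)) := by
  rw [lerayWeilIndex_def, ← weilIndexSpace_comp_linearEquiv μ hψ _ (lineCoords u v w hu hv hw)]
  set T := (kashiwaraForm B (F ∙ u) (F ∙ v) (F ∙ w)).comp
    ((lineCoords u v w hu hv hw : (F × (F × F)) ≃ₗ[F] _) : (F × (F × F)) →ₗ[F] _) with hT
  have hTp : ∀ p : F × (F × F), T p = B u v * (p.1 * p.2.1) + B v w * (p.2.1 * p.2.2) + B w u * (p.2.2 * p.1) :=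
    kashiwaraForm_span_singleton_apply B hu hv hw
  set a := B u v
  set b := B v w
  set c := B w u
  split_ifs with h0
  · -- a split form: `γ = 1`
    rcases mul_eq_zero.1 h0 with h0 | hc
    · rcases mul_eq_zero.1 h0 with ha | hb
      · -- `a = 0`: `T = z (b y + c x)` splits along `(x, y) ⊕ z`
        rw [← weilIndexSpace_comp_linearEquiv μ hψ T (LinearEquiv.prodAssoc F F F F)]
        refine weilIndexSpace_eq_one_of_split μ hψ _ (fun m => ?_) (fun n => ?_)
        · rw [QuadraticMap.comp_apply, LinearEquiv.coe_coe]
          change T (m.1, (m.2, 0)) = 0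
          rw [hTp]
          simp [ha]
        · rw [QuadraticMap.comp_apply, LinearEquiv.coe_coe]
          change T (0, (0, n)) = 0
          rw [hTp]
          simp
      · -- `b = 0`: `T = x (a y + c z)` splits along `x ⊕ (y, z)`
        refine weilIndexSpace_eq_one_of_split μ hψ T (fun m => ?_) (fun n => ?_)
        · rw [hTp]
          change a * (m * 0) + b * (0 * 0) + c * (0 * m) = 0
          simp
        · rw [hTp]
          change a * (0 * n.1) + b * (n.1 * n.2) + c * (n.2 * 0) = 0
          simp [hb]
    · -- `c = 0`: `T = y (a x + b z)` splits along `y ⊕ (x, z)`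
      rw [← weilIndexSpace_comp_linearEquiv μ hψ T swap₁₂]
      refine weilIndexSpace_eq_one_of_split μ hψ _ (fun m => ?_) (fun n => ?_)
      · rw [QuadraticMap.comp_apply, LinearEquiv.coe_coe]
        change T (0, (m, 0)) = 0
        rw [hTp]
        simp
      · rw [QuadraticMap.comp_apply, LinearEquiv.coe_coe]
        change T (n.1, (0, n.2)) = 0
        rw [hTp]
        simp [hc]
  · -- the non-degenerate case: `T = s t - (bc/a) z²` after `splitCoords`
    have ha : a ≠ 0 := fun h => h0 (by rw [h, zero_mul, zero_mul])
    set Q' : QuadraticForm F ((F × F) × (Fin 1 → F)) :=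
      (pairingQF (LinearMap.mul F F)).prod (weightedSumSquares F (fun _ : Fin 1 => -(b * c / a))) with hQ'
    have hQ'p : ∀ q : (F × F) × (Fin 1 → F), Q' q = q.1.1 * q.1.2 + -(b * c / a) * (q.2 0 * q.2 0) := fun q => by
      rw [hQ', QuadraticMap.prod_apply, pairingQF_apply, LinearMap.mul_apply', weightedSumSquares_apply,
        Fin.sum_univ_one, smul_eq_mul]
    have hTQ : T = Q'.comp ((splitCoords a b c ha : (F × (F × F)) ≃ₗ[F] _) : (F × (F × F)) →ₗ[F] _) := by
      refine QuadraticMap.ext fun p => ?_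
      rw [hTp, QuadraticMap.comp_apply, LinearEquiv.coe_coe, splitCoords_apply, hQ'p]
      field_simp
      ring
    rw [hTQ, weilIndexSpace_comp_linearEquiv μ hψ, hQ', weilIndexSpace_prod μ hψ, weilIndexSpace_pairingQF μ hψ,
      one_mul, weilIndexSpace_weightedSumSquares_one μ hψ]
    · have e : -(b * c / a) = -(a * b * c) * a⁻¹ ^ 2 := by field_simp
      rw [e]
      exact weilIndex_mul_sq μ hψ (neg_ne_zero.2 h0) (Invertible.ne_zero 2) (inv_ne_zero ha)
    · exact neg_ne_zero.2 (div_ne_zero (fun h => h0 (by rw [mul_assoc, h, mul_zero])) ha)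

/-! ## §3 The rank-one Leray cocycle ([Rangarao1993] Cor. 4.3) -/

omit [ValuativeRel F] [TopologicalSpace F] [IsNonarchimedeanLocalField F] [MeasurableSpace F] [BorelSpace F]
  [Invertible (2 : F)] [FiniteDimensional F V] in
/-- `g(Fu) = F(gu)`. [folklore] -/
private theorem map_span_singleton' (u : V) (g : V ≃ₗ[F] V) :
    (F ∙ u).map (g : V →ₗ[F] V) = F ∙ (g u) := by
  rw [Submodule.map_span, Set.image_singleton, LinearEquiv.coe_coe]

/-- **[Rangarao1993, Cor. 4.3] for the Leray cocycle of a Lagrangian line**: for `B` alternating, `u ≠ 0`, `g₁` an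
isometry and `x(g) = B(u, gu)` (the lower-left entry of `g` in a symplectic basis `(u, u*)`: for `g₁g₂` it is Rao's
`c₁a₂ + d₁c₂`), `c_{Fu}(g₁, g₂) = γ_ψ(x(g₁) x(g₂) x(g₁g₂))` if `x(g₁) x(g₂) x(g₁g₂) ≠ 0` and `= 1` otherwise.
[cite: Rangarao1993, Cor. 4.3, p. 359] -/
theorem lerayCocycle_span_singleton (hψ : ψ.IsContinuousNontrivial) {B : LinearMap.BilinForm F V}
    (hB : LinearMap.IsAlt B) {u : V} (hu : u ≠ 0) {g₁ : V ≃ₗ[F] V} (hg₁ : ∀ x y, B (g₁ x) (g₁ y) = B x y)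
    (g₂ : V ≃ₗ[F] V) :
    lerayCocycle ψ μ B (F ∙ u) g₁ g₂ =
      if B u (g₁ u) * B u (g₂ u) * B u ((g₁ * g₂) u) = 0 then 1
      else weilIndex ψ μ (B u (g₁ u) * B u (g₂ u) * B u ((g₁ * g₂) u)) := by
  rw [lerayCocycle_def, map_span_singleton', map_span_singleton',
    lerayWeilIndex_span_singleton μ hψ B hu (g₁.map_ne_zero_iff.2 hu) ((g₁ * g₂).map_ne_zero_iff.2 hu)]
  have h2 : B (g₁ u) ((g₁ * g₂) u) = B u (g₂ u) := by rw [LinearEquiv.mul_apply, hg₁]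
  have h3 : B ((g₁ * g₂) u) u = -B u ((g₁ * g₂) u) := (hB.neg _ _).symm
  rw [h2, h3, mul_neg, neg_neg, neg_eq_zero]

end Lines

end Literature.NumberTheory.Weil1964
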